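import Summits.Ventures.PercRepro.ProfilePointedCircuitClassesStarSharpParXD1
import Summits.Ventures.PercRepro.ProfilePointedCircuitClassesStarSharpRegimes

/-!
# PercRepro — THE REGIME `b ∥ y`, `y ∈ X`, OF CASE D0, PART E: THE BAD DEMANDS ARE AT MOST THE C-TARGETS
(p5, gen 55; `proofs/P5-GM1.md` §82 ADD 7)

`parX_on_target_mem`: an ON C-point gives a target of the fourth kind; `parX_B_on_cpoint`: a bad demand without
`c1` has an ON C-endpoint; `parX_card_bad_le`: the bad demands are at most the targets of the fourth and fifth
kinds — if no bad demand has `c1` they are defects of `R` and the generic count applies (with (L0) for the size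
bound); otherwise there is at most one bad demand without `c1` (the key lemma), it has a target of the fourth kind,
and the bad demands with `c1` are at most the OFF C-points (part C).
-/

open scoped Matroid

namespace PercRepro.Cogirth

open Finset ThmH Skew Shadow Profile

open Classical

variable {α : Type} [DecidableEq α] {N : Matroid α} [N.Finite]

section StarSharpParXE

variable {b b' : α}

/-- **THE FOURTH KIND OF TARGET**: an ON C-point `x` (`y ∈ cl{e, f, x}`) gives `{e, f, x} + b`, bi-independent with
a complement that is not. -/
theorem parX_on_target_mem (hn : (gr N).card = 9) (h : SeriesPair N b b') {e f : α} (he : e ∈ gr N) (hf : f ∈ gr N)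
    (hef : e ≠ f) (heb : e ≠ b) (heb' : e ≠ b') (hfb : f ≠ b) (hfb' : f ≠ b')
    (he1 : ∀ y ∈ ((((gr N).erase b).erase b').erase f).erase e, rk N {e, y} = 2)
    {y : α} (hyX : y ∈ ((((gr N).erase b).erase b').erase f).erase e) (hpar : rk N {y, b, b'} = 2)
    (hbb2 : rk N {b, b'} = 2) {x : α} (hx : x ∈ ((((gr N).erase b).erase b').erase f).erase e)
    (hefx : rk N {e, f, x} = 3) (hx4 : rk N ((((((gr N).erase b).erase b').erase f).erase e).erase x) = 4)
    (hon : rk N (insert y {e, f, x}) = 3) :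
    insert b {e, f, x} ∈ (biIndepSets N 4).filter (fun W => (f ∈ W ∧ b' ∉ W) ∧
      (e ∈ W ∧ b ∈ W ∧ ¬ (gr N \ W).erase b' ∈ biIndepSets N 4)) := by
  have hXE : ((((gr N).erase b).erase b').erase f).erase e ⊆ ((gr N).erase b).erase b' :=
    (erase_subset _ _).trans (erase_subset _ _)
  have hXg : ((((gr N).erase b).erase b').erase f).erase e ⊆ gr N :=
    hXE.trans ((erase_subset _ _).trans (erase_subset _ _))
  have hfE : f ∈ ((gr N).erase b).erase b' := mem_erase.2 ⟨hfb', mem_erase.2 ⟨hfb, hf⟩⟩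
  have heE : e ∈ ((gr N).erase b).erase b' := mem_erase.2 ⟨heb', mem_erase.2 ⟨heb, he⟩⟩
  have hy1 : rk N ({y} : Finset α) = 1 := by
    have h1 := rk_insert_le_add_one (N := N) he (X := ({y} : Finset α)) (singleton_subset_iff.2 (hXg hyX))
    have h2 := rk_le_card' (M := N) ({y} : Finset α)
    rw [card_singleton] at h2
    rw [he1 y hyX] at h1
    omega
  have hbb' : b ≠ b' := h.2.2.1
  have hS : ({e, f, x} : Finset α) ⊆ ((gr N).erase b).erase b' := by
    intro w hw; simp only [mem_insert, mem_singleton] at hw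
    rcases hw with rfl | rfl | rfl
    · exact heE
    · exact hfE
    · exact hXE hx
  have hS3' : ({e, f, x} : Finset α).card = 3 := by
    have hxe : x ≠ e := (mem_erase.1 hx).1
    have hxf : x ≠ f := (mem_erase.1 (mem_erase.1 hx).2).1
    rw [card_insert_of_notMem, card_pair hxf.symm]
    simp only [mem_insert, mem_singleton, not_or]; exact ⟨hef, hxe.symm⟩
  simp only [mem_filter]
  refine ⟨?_, ⟨mem_insert_of_mem (mem_insert_of_mem (mem_insert_self _ _)), ?_⟩,
    mem_insert_of_mem (mem_insert_self _ _), mem_insert_self _ _, ?_⟩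
  · rw [insert_b_mem_biIndepSets_iff h hn hS hS3', E7_sdiff_efx_eq]
    exact ⟨hefx, hx4⟩
  · intro h'
    simp only [mem_insert, mem_singleton] at h'
    rcases h' with h2 | h2 | h2 | h2
    · exact hbb' h2.symm
    · exact heb' h2.symm
    · exact hfb' h2.symm
    · exact (mem_erase.1 (hXE hx)).1 h2.symm
  · rw [off_image_efx_iff h hn he hf hef heb heb' hfb hfb' hx]
    rintro ⟨-, h5⟩
    have h4 : rk N (insert b (insert b' {e, f, x})) = rk N {e, f, x} + 1 := by
      rw [on_iff_of_parallel h (hXE hyX) hy1 hpar hbb2 hS, hon, hefx]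
    rw [hefx] at h4
    omega

/-- A bad demand without `c1` has an ON C-endpoint. -/
theorem parX_B_on_cpoint (hn : (gr N).card = 9) (h : SeriesPair N b b') {e f : α} (he : e ∈ gr N) (hf : f ∈ gr N)
    (hef : e ≠ f) (heb : e ≠ b) (heb' : e ≠ b') (hfb : f ≠ b) (hfb' : f ≠ b')
    (he1 : ∀ y ∈ ((((gr N).erase b).erase b').erase f).erase e, rk N {e, y} = 2)
    (hf1 : ∀ y ∈ ((((gr N).erase b).erase b').erase f).erase e, rk N {f, y} = 2)
    (hX : rk N (((((gr N).erase b).erase b').erase f).erase e) = 4) (hef2 : rk N {e, f} = 2)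
    {y : α} (hyX : y ∈ ((((gr N).erase b).erase b').erase f).erase e) (hpar : rk N {y, b, b'} = 2)
    (hbb2 : rk N {b, b'} = 2) {W : Finset α} (hW : W ∈ d0DON N b' e f) (hc0 : ¬ d0c0 N b b' e f W)
    (hc1 : ¬ d0c1 N b e f W) :
    ∃ x ∈ (W.erase b).erase e, rk N {e, f, x} = 3 ∧ rk N ((((((gr N).erase b).erase b').erase f).erase e).erase x) = 4 ∧
      rk N (insert y {e, f, x}) = 3 := by
  have hXE : ((((gr N).erase b).erase b').erase f).erase e ⊆ ((gr N).erase b).erase b' :=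
    (erase_subset _ _).trans (erase_subset _ _)
  have hXg : ((((gr N).erase b).erase b').erase f).erase e ⊆ gr N :=
    hXE.trans ((erase_subset _ _).trans (erase_subset _ _))
  have heE : e ∈ ((gr N).erase b).erase b' := mem_erase.2 ⟨heb', mem_erase.2 ⟨heb, he⟩⟩
  have hy1 : rk N ({y} : Finset α) = 1 := by
    have h1 := rk_insert_le_add_one (N := N) he (X := ({y} : Finset α)) (singleton_subset_iff.2 (hXg hyX))
    have h2 := rk_le_card' (M := N) ({y} : Finset α)
    rw [card_singleton] at h2
    rw [he1 y hyX] at h1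
    omega
  have hWd := hW
  simp only [d0DON, mem_filter] at hWd
  obtain ⟨-, hπX, hπ2, -, -, hπe, hYf, hon⟩ := d0_demand_data h hn hf hef heb hfb hfb' (e := e) W hWd.1 hWd.2.1 hWd.2.2
  have hres := parX_no_swap_of_not_c1 hn h he hf hef heb heb' hfb hfb' he1 hyX hpar hbb2 hW hc0 hc1
  obtain ⟨x, hxπ, hx3, hx4⟩ := c_point_exists h hn he hf hef heb heb' hfb hfb' hef2 he1 hf1 hX hπX hπ2 hπe hYf hres
  refine ⟨x, hxπ, hx3, hx4, ?_⟩
  have hyπ : rk N (insert y (insert e ((W.erase b).erase e))) = rk N (insert e ((W.erase b).erase e)) :=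
    (on_iff_of_parallel h (hXE hyX) hy1 hpar hbb2 (insert_subset heE (hπX.trans hXE))).1 (by rw [hπe]; exact hon)
  unfold d0c1 at hc1
  have h1 := rk_insert_le_add_one (N := N) hf (X := insert e ((W.erase b).erase e)) (insert_subset he (hπX.trans hXg))
  have h2 : rk N (insert e ((W.erase b).erase e)) ≤ rk N (insert f (insert e ((W.erase b).erase e))) :=
    rk_mono' (subset_insert _ _)
  rw [hπe] at h1 h2
  have h3 : rk N (insert f (insert e ((W.erase b).erase e))) = 3 := by omega
  have h4 := rk_insert_eq_of_rk_insert_eq_subset' (N := N) (S := insert e ((W.erase b).erase e))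
    (S' := insert f (insert e ((W.erase b).erase e))) (w := y) (subset_insert _ _) hyπ
  rw [h3] at h4
  have h5 : rk N (insert y {e, f, x}) ≤ rk N (insert y (insert f (insert e ((W.erase b).erase e)))) :=
    rk_mono' (by
      intro u hu; simp only [mem_insert, mem_singleton] at hu
      rcases hu with rfl | rfl | rfl | rfl
      · exact mem_insert_self _ _
      · exact mem_insert_of_mem (mem_insert_of_mem (mem_insert_self _ _))
      · exact mem_insert_of_mem (mem_insert_self _ _)
      · exact mem_insert_of_mem (mem_insert_of_mem (mem_insert_of_mem hxπ)))
  have h6 : rk N {e, f, x} ≤ rk N (insert y {e, f, x}) := rk_mono' (subset_insert _ _)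
  rw [h4] at h5
  rw [hx3] at h6
  omega

/-- **THE BAD DEMANDS ARE AT MOST THE TARGETS OF THE FOURTH AND FIFTH KINDS** (regime `b ∥ y`). -/
theorem parX_card_bad_le (hn : (gr N).card = 9) (h : SeriesPair N b b') {e f : α} (he : e ∈ gr N) (hf : f ∈ gr N)
    (hef : e ≠ f) (heb : e ≠ b) (heb' : e ≠ b') (hfb : f ≠ b) (hfb' : f ≠ b')
    (he1 : ∀ y ∈ ((((gr N).erase b).erase b').erase f).erase e, rk N {e, y} = 2)
    (hf1 : ∀ y ∈ ((((gr N).erase b).erase b').erase f).erase e, rk N {f, y} = 2)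
    (hfc : ∀ y ∈ ((((gr N).erase b).erase b').erase f).erase e, rk N (((((gr N).erase b).erase b').erase f).erase y) = 4)
    (hX : rk N (((((gr N).erase b).erase b').erase f).erase e) = 4) (hef2 : rk N {e, f} = 2)
    {y : α} (hyX : y ∈ ((((gr N).erase b).erase b').erase f).erase e) (hpar : rk N {y, b, b'} = 2)
    (hbb2 : rk N {b, b'} = 2) :
    ((d0DON N b' e f).filter (fun W => ¬ d0c0 N b b' e f W ∧ ¬ (d0c1 N b e f W ∧ d0c2 N b b' e f W))).card ≤
      ((biIndepSets N 4).filter (fun W => (f ∈ W ∧ b' ∉ W) ∧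
        (e ∈ W ∧ b ∈ W ∧ ¬ (gr N \ W).erase b' ∈ biIndepSets N 4))).card +
      ((biIndepSets N 4).filter (fun W => (f ∈ W ∧ b' ∉ W) ∧
        (e ∈ W ∧ b ∈ W ∧ (gr N \ W).erase b' ∈ biIndepSets N 4))).card := by
  have hXg : ((((gr N).erase b).erase b').erase f).erase e ⊆ gr N :=
    (erase_subset _ _).trans ((erase_subset _ _).trans ((erase_subset _ _).trans (erase_subset _ _)))
  -- the split of the bad class by `c1`
  have hsplit : (d0DON N b' e f).filter (fun W => ¬ d0c0 N b b' e f W ∧ ¬ (d0c1 N b e f W ∧ d0c2 N b b' e f W)) ⊆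
      (d0DON N b' e f).filter (fun W => ¬ d0c0 N b b' e f W ∧ (d0c1 N b e f W ∧ ¬ d0c2 N b b' e f W)) ∪
      (d0DON N b' e f).filter (fun W => ¬ d0c0 N b b' e f W ∧ ¬ d0c1 N b e f W) := by
    intro W hW
    have hW' := mem_filter.1 hW
    by_cases hc1 : d0c1 N b e f W
    · exact mem_union_left _ (mem_filter.2 ⟨hW'.1, hW'.2.1, hc1, fun h' => hW'.2.2 ⟨hc1, h'⟩⟩)
    · exact mem_union_right _ (mem_filter.2 ⟨hW'.1, hW'.2.1, hc1⟩)
  have hA := (parX_card_A_le_card_Coff hn h he hf hef heb heb' hfb hfb' he1 hf1 hfc hX hyX hpar hbb2).trans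
    (parX_card_Coff_le_targets hn h he hf hef heb heb' hfb hfb' he1 hyX hpar hbb2)
  by_cases hAe : ∃ W ∈ d0DON N b' e f, ¬ d0c0 N b b' e f W ∧ (d0c1 N b e f W ∧ ¬ d0c2 N b b' e f W)
  · -- some bad demand has `c1`: the others (without `c1`) are at most one
    obtain ⟨W, hW, hc0, hc1, hc2⟩ := hAe
    have hB1 : ((d0DON N b' e f).filter (fun W => ¬ d0c0 N b b' e f W ∧ ¬ d0c1 N b e f W)).card ≤ 1 := by
      apply card_le_one.2
      intro W₁ hW₁ W₂ hW₂
      have h1 := mem_filter.1 hW₁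
      have h2 := mem_filter.1 hW₂
      exact parX_not_two_B_of_A hn h he hf hef heb heb' hfb hfb' he1 hf1 hfc hX hyX hpar hbb2 hW hc0 hc1 hc2 h1.1 h1.2.1
        h1.2.2 h2.1 h2.2.1 h2.2.2
    have hB4 : ((d0DON N b' e f).filter (fun W => ¬ d0c0 N b b' e f W ∧ ¬ d0c1 N b e f W)).card ≤
        ((biIndepSets N 4).filter (fun W => (f ∈ W ∧ b' ∉ W) ∧
          (e ∈ W ∧ b ∈ W ∧ ¬ (gr N \ W).erase b' ∈ biIndepSets N 4))).card := by
      rcases Nat.le_one_iff_eq_zero_or_eq_one.1 hB1 with h0 | h1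
      · rw [h0]; exact Nat.zero_le _
      · obtain ⟨W₁, hW₁⟩ := card_eq_one.1 h1
        have hmem : W₁ ∈ (d0DON N b' e f).filter (fun W => ¬ d0c0 N b b' e f W ∧ ¬ d0c1 N b e f W) := by
          rw [hW₁]; exact mem_singleton_self _
        have h2 := mem_filter.1 hmem
        obtain ⟨x, hxπ, hx3, hx4, hxon⟩ := parX_B_on_cpoint hn h he hf hef heb heb' hfb hfb' he1 hf1 hX hef2 hyX hpar
          hbb2 h2.1 h2.2.1 h2.2.2
        have hWd := h2.1
        simp only [d0DON, mem_filter] at hWd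
        have hπX := (d0_demand_data h hn hf hef heb hfb hfb' (e := e) W₁ hWd.1 hWd.2.1 hWd.2.2).2.1
        have h3 := parX_on_target_mem hn h he hf hef heb heb' hfb hfb' he1 hyX hpar hbb2 (hπX hxπ) hx3 hx4 hxon
        rw [h1]
        exact card_pos.2 ⟨_, h3⟩
    have h5 := card_le_card hsplit
    have h6 := card_union_le
      ((d0DON N b' e f).filter (fun W => ¬ d0c0 N b b' e f W ∧ (d0c1 N b e f W ∧ ¬ d0c2 N b b' e f W)))
      ((d0DON N b' e f).filter (fun W => ¬ d0c0 N b b' e f W ∧ ¬ d0c1 N b e f W))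
    omega
  · -- no bad demand has `c1`: every bad demand is a defect of `R`; the generic count over both kinds of target
    push Not at hAe
    have hP : ∀ W ∈ (d0DON N b' e f).filter (fun W => ¬ d0c0 N b b' e f W ∧ ¬ (d0c1 N b e f W ∧ d0c2 N b b' e f W)),
        ¬ (rk N (insert f ((W.erase b).erase e)) = 3 ∧
          rk N (insert e (((((gr N).erase b).erase b').erase f).erase e \ (W.erase b).erase e)) = 4) := by
      intro W hW
      have hW' := mem_filter.1 hW
      have hc1 : ¬ d0c1 N b e f W := fun hc1 => hW'.2.2 ⟨hc1, hAe W hW'.1 hW'.2.1 hc1⟩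
      exact parX_no_swap_of_not_c1 hn h he hf hef heb heb' hfb hfb' he1 hyX hpar hbb2 hW'.1 hW'.2.1 hc1
    have hcount := card_bad_le_targets_of_card_le_three_P hn h he hf hef heb heb' hfb hfb' he1 hf1 hfc hX hef2
      (P := fun W => ¬ d0c0 N b b' e f W ∧ ¬ (d0c1 N b e f W ∧ d0c2 N b b' e f W))
      (T := (biIndepSets N 4).filter (fun W => (f ∈ W ∧ b' ∉ W) ∧
          (e ∈ W ∧ b ∈ W ∧ ¬ (gr N \ W).erase b' ∈ biIndepSets N 4)) ∪
        (biIndepSets N 4).filter (fun W => (f ∈ W ∧ b' ∉ W) ∧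
          (e ∈ W ∧ b ∈ W ∧ (gr N \ W).erase b' ∈ biIndepSets N 4))) hP
      (by
        intro x hx hefx hx4
        have hbnd1 : rk N {e, f, x} ≤ rk N (insert y {e, f, x}) := rk_mono' (subset_insert _ _)
        have hbnd2 := rk_insert_le_add_one (N := N) (hXg hyX) (X := {e, f, x})
          (insert_subset he (insert_subset hf (singleton_subset_iff.2 (hXg hx))))
        rw [hefx] at hbnd1 hbnd2
        by_cases hon : rk N (insert y {e, f, x}) = 3
        · exact mem_union_left _ (parX_on_target_mem hn h he hf hef heb heb' hfb hfb' he1 hyX hpar hbb2 hx hefx hx4 hon)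
        · have hoff : rk N (insert y {e, f, x}) = 4 := by omega
          exact mem_union_right _
            (parX_off_target_mem hn h he hf hef heb heb' hfb hfb' he1 hyX hpar hbb2 hx hefx hx4 hoff))
      (by
        apply card_le_three_of_no_four
        intro W₁ h1 W₂ h2 W₃ h3 W₄ h4
        simp only [mem_filter] at h1 h2 h3 h4
        exact hthree_of_defects hn h he hf hef heb heb' hfb hfb' he1 hf1 hfc hX W₁ h1.1 W₂ h2.1 W₃ h3.1 W₄ h4.1
          (hP W₁ (mem_filter.2 h1)) (hP W₂ (mem_filter.2 h2)) (hP W₃ (mem_filter.2 h3)) (hP W₄ (mem_filter.2 h4)))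
    exact hcount.trans (card_union_le _ _)

end StarSharpParXE

end PercRepro.Cogirth
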